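import Summits.CriticalPhenomena.SAWScalingLimit.Theorems.SAWLoopFugacityFlowAvoidancePassageFinite
import Summits.CriticalPhenomena.SAWScalingLimit.Theorems.SAWRenewalTightnessSubseqIdentificationWindowTransport
import Literature.Probability.RandomPlanarGeometry.ChordalCurveFamily
import HarnessLib

/-!
# `stub_halfBallSubdomain`: carving a closed half-ball at a flat window off a Dobrushin domain

Stub RS2a `stub_halfBallSubdomain` of the registered skeleton of the line `boundary-area-law`
(restriction reshape) for the crux `SubseqIdentification` (stmt-CriticalPhenomena-0783, route
`SAWRenewalTightness`; primary decl `SAWParafermion.SubseqIdentification`, identical shared decl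
`SAWRenewalTightness.SubseqIdentification`).

Statement. Let `(D; a, b)` be a Dobrushin domain with a FLAT HORIZONTAL WINDOW at `x₀`,
`D ∩ B(x₀, ρ₀) = {im z > im x₀} ∩ B(x₀, ρ₀)`, whose closed window ball misses the marked points
(`ρ₀ ≤ |x₀ - a|`, `ρ₀ ≤ |x₀ - b|`). Then for `0 < r < ρ₀` the carved set `D ∖ B̄(x₀, r)` is the
carrier of a Dobrushin domain with the same marked points `a`, `b`.

Proof (a corollary of the carving lemmas of `…AvoidancePassageCarving` / `…Finite`). Pick
`r < ρ' < ρ₀` and chart the window by the similarity `h z = ρ' z + x₀`: it maps the open upper half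
unit disc `𝔻 ∩ ℍ` onto the half-ball `B(x₀, ρ') ∩ {im > im x₀} ⊆ D` (a Jordan domain,
`JordanDomain.map` of `halfDisc 1`, `image_chart_halfDisc`) and the open diameter into the wall
`{im = im x₀} ∩ B(x₀, ρ₀) ⊆ ∂D` (`window_mem_iff`). Newman's carving lemma `exists_carve` (with
`Ω = D`, radius `r/ρ' < 1`) produces a Jordan domain with carrier
`D ∖ h(closed upper half-disc of radius r/ρ') = D ∖ (B̄(x₀, r) ∩ {im ≥ im x₀}) = D ∖ B̄(x₀, r)`
(`image_chart_closedHalfDisc`; points of `B̄(x₀, r)` below the wall are not in `D`). The marked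
points lie off `B̄(x₀, r)`, hence are still frontier points of the carved domain, and
`exists_dobrushinDomain_of_mem_frontier` re-marks them.

No named fact is used.
-/

noncomputable section

open Filter Topology Set Metric Complex
open Literature.Probability.RandomPlanarGeometry
open Literature.Topology.PlaneTopology (halfDisc)
open UpperHalfPlane (upperHalfPlaneSet)
open Summit.CriticalPhenomena.SAWScalingLimit.Theorems.AvoidancePassage
  (exists_carve exists_dobrushinDomain_of_mem_frontier)

namespace Summit.CriticalPhenomena.SAWScalingLimit.Theorems.SubseqIdentification.BoundaryAreaLaw

/-! ## The affine chart of a flat window -/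

section Chart

variable {h : ℂ ≃ₜ ℂ} {ρ' : ℝ} {x₀ : ℂ}

/-- Distance of a charted point `ρ' z + x₀` (`ρ' > 0`) from the centre `x₀` is `ρ' ‖z‖`.
[folklore] -/
theorem dist_chart (hh : ∀ z, h z = ρ' * z + x₀) (hρ' : 0 < ρ') (z : ℂ) :
    dist (h z) x₀ = ρ' * ‖z‖ := by
  rw [hh, dist_eq_norm, add_sub_cancel_right, norm_mul, norm_real, Real.norm_eq_abs,
    abs_of_pos hρ']

/-- Imaginary part of a charted point `ρ' z + x₀`. [folklore] -/
theorem im_chart (hh : ∀ z, h z = ρ' * z + x₀) (z : ℂ) : (h z).im = ρ' * z.im + x₀.im := by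
  rw [hh, add_im, im_ofReal_mul]

/-- The chart `z ↦ ρ' z + x₀` (`ρ' > 0`) hits `z` at the parameter `(z - x₀) / ρ'`. [folklore] -/
theorem chart_div (hh : ∀ z, h z = ρ' * z + x₀) (hρ' : 0 < ρ') (z : ℂ) :
    h ((z - x₀) / ρ') = z := by
  rw [hh, mul_div_cancel₀ _ (ofReal_ne_zero.2 hρ'.ne'), sub_add_cancel]

/-- Modulus of the parameter `(z - x₀) / ρ'`. [folklore] -/
theorem norm_sub_div (hρ' : 0 < ρ') (z : ℂ) : ‖(z - x₀) / ρ'‖ = dist z x₀ / ρ' := by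
  rw [norm_div, norm_real, Real.norm_eq_abs, abs_of_pos hρ', dist_eq_norm]

/-- **The chart maps the open upper half unit disc onto the open upper half-ball.** [folklore] -/
theorem image_chart_halfDisc (hh : ∀ z, h z = ρ' * z + x₀) (hρ' : 0 < ρ') :
    h '' (ball 0 1 ∩ upperHalfPlaneSet) = ball x₀ ρ' ∩ {z : ℂ | x₀.im < z.im} := by
  ext z
  constructor
  · rintro ⟨w, ⟨hw1, hw2⟩, rfl⟩
    rw [mem_ball, dist_zero_right] at hw1
    have hw2' : 0 < w.im := hw2
    refine ⟨?_, ?_⟩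
    · rw [mem_ball, dist_chart hh hρ']
      nlinarith
    · show x₀.im < (h w).im
      rw [im_chart hh]
      nlinarith
  · rintro ⟨hz1, hz2⟩
    have hz2' : x₀.im < z.im := hz2
    rw [mem_ball] at hz1
    refine ⟨(z - x₀) / ρ', ⟨?_, ?_⟩, chart_div hh hρ' z⟩
    · rw [mem_ball, dist_zero_right, norm_sub_div hρ', div_lt_one hρ']
      exact hz1
    · show 0 < ((z - x₀) / ρ').im
      rw [div_ofReal_im, sub_im]
      exact div_pos (by linarith) hρ'

/-- **The chart maps the closed upper half-disc of radius `s` onto the closed upper half-ball of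
radius `ρ' s`.** [folklore] -/
theorem image_chart_closedHalfDisc (hh : ∀ z, h z = ρ' * z + x₀) (hρ' : 0 < ρ') (s : ℝ) :
    h '' (closedBall 0 s ∩ {z : ℂ | 0 ≤ z.im}) =
      closedBall x₀ (ρ' * s) ∩ {z : ℂ | x₀.im ≤ z.im} := by
  ext z
  constructor
  · rintro ⟨w, ⟨hw1, hw2⟩, rfl⟩
    rw [mem_closedBall, dist_zero_right] at hw1
    have hw2' : 0 ≤ w.im := hw2
    refine ⟨?_, ?_⟩
    · rw [mem_closedBall, dist_chart hh hρ']
      nlinarith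
    · show x₀.im ≤ (h w).im
      rw [im_chart hh]
      nlinarith
  · rintro ⟨hz1, hz2⟩
    have hz2' : x₀.im ≤ z.im := hz2
    rw [mem_closedBall] at hz1
    refine ⟨(z - x₀) / ρ', ⟨?_, ?_⟩, chart_div hh hρ' z⟩
    · rw [mem_closedBall, dist_zero_right, norm_sub_div hρ', div_le_iff₀ hρ']
      linarith
    · show 0 ≤ ((z - x₀) / ρ').im
      rw [div_ofReal_im, sub_im]
      exact div_nonneg (by linarith) hρ'.le

end Chart

/-! ## The carved Dobrushin domain -/

/-- **Carving a closed half-ball at a flat window (stub RS2a `stub_halfBallSubdomain`).** Let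
`(D; a, b)` be a Dobrushin domain with a flat horizontal window
`D ∩ B(x₀, ρ₀) = {im z > im x₀} ∩ B(x₀, ρ₀)` at `x₀`, with `ρ₀ ≤ |x₀ - a|` and `ρ₀ ≤ |x₀ - b|`.
Then for `0 < r < ρ₀` there is a Dobrushin domain `D'` with carrier `D ∖ B̄(x₀, r)` and the same
marked points: Newman's carving lemma `exists_carve` for the affine chart `z ↦ ρ' z + x₀`
(`r < ρ' < ρ₀`) of the window, followed by re-marking
(`exists_dobrushinDomain_of_mem_frontier`). [folklore] -/
theorem stub_halfBallSubdomain :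
    ∀ (D : DobrushinDomain) (x₀ : ℂ) (ρ₀ r : ℝ), 0 < r → r < ρ₀ →
      D.carrier ∩ Metric.ball x₀ ρ₀ = {z : ℂ | x₀.im < z.im} ∩ Metric.ball x₀ ρ₀ →
      ρ₀ ≤ dist x₀ (D.pt 0) → ρ₀ ≤ dist x₀ (D.pt 1) →
      ∃ D' : DobrushinDomain,
        D'.carrier = D.carrier \ Metric.closedBall x₀ r ∧ D'.pt 0 = D.pt 0 ∧ D'.pt 1 = D.pt 1 := by
  intro D x₀ ρ₀ r hr hrρ hwin h0 h1
  -- the chart radius `ρ'`, `r < ρ' < ρ₀`, and the chart `h z = ρ' z + x₀`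
  obtain ⟨ρ', hrρ', hρ'ρ⟩ := exists_between hrρ
  have hρ' : 0 < ρ' := hr.trans hrρ'
  obtain ⟨h, hh⟩ : ∃ h : ℂ ≃ₜ ℂ, ∀ z, h z = ρ' * z + x₀ :=
    ⟨similarity (ρ' : ℂ) (ofReal_ne_zero.2 hρ'.ne') x₀, fun z ↦ rfl⟩
  have hwin' : ∀ z ∈ ball x₀ ρ₀, (z ∈ D.carrier ↔ x₀.im < z.im) ∧
      (z ∈ closure D.carrier ↔ x₀.im ≤ z.im) ∧ (z ∈ frontier D.carrier ↔ z.im = x₀.im) :=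
    fun z hz ↦ window_mem_iff D.isOpen hwin hz
  -- the charted half-ball `B ⊆ D`
  set B : JordanDomain := (halfDisc 1 one_pos).map h with hB_def
  have hhB : h '' (ball 0 1 ∩ upperHalfPlaneSet) = B.carrier := rfl
  have hBD : B.carrier ⊆ D.carrier := by
    rw [← hhB, image_chart_halfDisc hh hρ']
    rintro z ⟨hz1, hz2⟩
    exact ((hwin' z (ball_subset_ball hρ'ρ.le hz1)).1).2 hz2
  -- the open diameter is charted into the wall `⊆ ∂D`
  have hdiam : ∀ x : ℝ, |x| < 1 → h x ∈ frontier D.carrier := by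
    intro x hx
    have hxb : h x ∈ ball x₀ ρ₀ := by
      rw [mem_ball, dist_chart hh hρ', norm_real, Real.norm_eq_abs]
      nlinarith
    refine ((hwin' _ hxb).2.2).2 ?_
    rw [im_chart hh, ofReal_im, mul_zero, zero_add]
  -- carve
  have hρ1 : r / ρ' < 1 := (div_lt_one hρ').2 hrρ'
  obtain ⟨J, hJ⟩ := exists_carve D.toJordanDomain D.toJordanDomain B h (div_pos hr hρ') hρ1
    Subset.rfl hBD hhB hdiam
  have hJ' : J.carrier = D.carrier \ closedBall x₀ r := by
    rw [hJ, image_chart_closedHalfDisc hh hρ', mul_div_cancel₀ _ hρ'.ne']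
    ext z
    constructor
    · rintro ⟨hzD, hzK⟩
      refine ⟨hzD, fun hzb ↦ hzK ⟨hzb, ?_⟩⟩
      exact (((hwin' z (closedBall_subset_ball hrρ hzb)).1).1 hzD).le
    · rintro ⟨hzD, hzb⟩
      exact ⟨hzD, fun hK ↦ hzb hK.1⟩
  -- the marked points are frontier points of the carved domain
  have hab : D.pt 0 ≠ D.pt 1 := fun h ↦ absurd (D.pt_injective h) (by decide)
  have hfr : ∀ i, ρ₀ ≤ dist x₀ (D.pt i) → D.pt i ∈ frontier J.carrier := by
    intro i hi
    have hpt := D.pt_mem_frontier i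
    have hnot : D.pt i ∉ D.carrier := fun hm ↦
      Set.disjoint_left.1 D.disjoint_carrier_frontier hm hpt
    rw [J.isOpen.frontier_eq, hJ']
    refine ⟨?_, fun hm ↦ hnot hm.1⟩
    have hU : IsOpen (closedBall x₀ r)ᶜ := isClosed_closedBall.isOpen_compl
    have hmemU : D.pt i ∈ (closedBall x₀ r)ᶜ := by
      rw [mem_compl_iff, mem_closedBall, dist_comm, not_le]
      linarith
    have hcl := hU.inter_closure ⟨hmemU, frontier_subset_closure hpt⟩
    rwa [inter_comm, ← Set.sdiff_eq] at hcl
  obtain ⟨E, hE, hE0, hE1⟩ :=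
    exists_dobrushinDomain_of_mem_frontier J (hfr 0 h0) (hfr 1 h1) hab
  exact ⟨E, hE.trans hJ', hE0, hE1⟩

end Summit.CriticalPhenomena.SAWScalingLimit.Theorems.SubseqIdentification.BoundaryAreaLaw

end
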